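import Mathlib
import Literature.RingTheory.NoetherNormalization.LinearFamily
import HarnessLib

/-!
# The Nagata power shear with exponents divisible by the characteristic

Topic `Literature/RingTheory/NoetherNormalization`.  One step of Noether normalisation by
Nagata's change of variables `X_i ↦ X_i + X_0^{N^i}` (`i ≥ 1`), as in Mathlib's
`Mathlib.RingTheory.NoetherNormalization`, but with the base `N` a free parameter: when `N` is a
multiple of the characteristic `p`, the partial derivative `∂/∂X_0` COMMUTES with the shear
(the cross terms `N^i X_0^{N^i - 1} ∂f/∂X_i` of the chain rule vanish identically), so the
integral equation of `x_0` over `k[x_1 - x_0^{N}, …, x_n - x_0^{N^n}]` produced from a relation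
`f(x) = 0` has derivative `(∂f/∂X_0)(x)` at `x_0` up to a unit.  This is the separability
mechanism of the SEPARABLE Noether normalisation over perfect fields
(`SeparableNoetherNormalization.lean`; Nagata, *Local Rings*, (39.11); Huneke–Swanson,
*Integral Closure of Ideals, Rings, and Modules*, Lemma 4.2.1 (2) / Thm. 4.2.2, whose proof
perturbs the exponents instead of taking them divisible by `p`).

* the power shear `T` (`X_0 ↦ X_0`, `X_i ↦ X_i + X_0^{N^i}`) is handled through its two
  defining values (hypotheses `h0`, `hs`; `powShear_spec` for the explicit `aeval`).
* `isUnit_leadingCoeff_finSuccEquiv_powShear` — for `f ≠ 0` all of whose exponents are `< N`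
  (`1 < N`), `T f` is a unit times a monic polynomial in `X_0`.
* `derivative_finSuccEquiv` — `d/dY (finSuccEquiv g) = finSuccEquiv (∂_0 g)`.
* `pderiv_zero_powShear` — `∂_0 (T f) = T (∂_0 f)` when `(N : k) = 0`.
* `isSeparable_of_aeval_derivative_ne_zero` — an element killed by a polynomial but not by its
  derivative is separable.
* `exists_monic_aevalTower_eq_zero_of_powShear` — the one-step package over any `k`-algebra `B`:
  from `f(x) = 0`, a monic `h ∈ k[X_1..X_n][Y]` with `h(z; x_0) = 0` for the sheared family
  `z_j = x_{j+1} - x_0^{N^{j+1}}`, and, when `(N : k) = 0`, `h'(z; x_0) = u · (∂_0 f)(x)` for a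
  unit `u`; `isIntegral_adjoin_powShear` — `x_0` is integral over `k[z]`;
  `adjoin_range_eq_adjoin_cons_powShear` — `k[x] = k[x_0, z]`.

## References

* C. Huneke, I. Swanson, *Integral Closure of Ideals, Rings, and Modules*, LMS Lecture Note
  Series 336 (2006), Lemma 4.2.1, Thm. 4.2.2. [HunekeSwanson2006]
* M. Nagata, *Local Rings* (1962), (39.11) (separable normalisation over perfect fields).
* Mathlib, `Mathlib.RingTheory.NoetherNormalization` (the case `N = 2 + deg f`, no derivative).
-/

noncomputable section

open Polynomial MvPolynomial

namespace Literature.RingTheory.NoetherNormalization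

universe u v

variable {k : Type u} [Field k] {n : ℕ}

/-! ### The power shear -/

section PowShear

/-! Throughout, `T` is Nagata's power shear with base `N`: the `k`-algebra endomorphism of
`k[X_0, …, X_n]` with `T (X 0) = X 0` and `T (X (j+1)) = X (j+1) + X 0 ^ (N ^ (j + 1))`; it is
characterised by these values (`MvPolynomial.algHom_ext`), and
`MvPolynomial.aeval (fun i => if i = 0 then X 0 else X i + X 0 ^ (N ^ i))` is such a `T`
(`powShear_spec`). -/

variable {N : ℕ} {T : MvPolynomial (Fin (n + 1)) k →ₐ[k] MvPolynomial (Fin (n + 1)) k}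

/-- The explicit power shear `X_0 ↦ X_0`, `X_i ↦ X_i + X_0^{N^i}` has the two defining values.
[folklore] -/
private theorem powShear_spec (N : ℕ) :
    (MvPolynomial.aeval (R := k) (fun i : Fin (n + 1) => if i = 0 then
        (X 0 : MvPolynomial (Fin (n + 1)) k) else X i + X 0 ^ (N ^ (i : ℕ)))
        (X 0 : MvPolynomial (Fin (n + 1)) k) = X 0) ∧
    ∀ j : Fin n, (MvPolynomial.aeval (R := k) (fun i : Fin (n + 1) => if i = 0 then
        (X 0 : MvPolynomial (Fin (n + 1)) k) else X i + X 0 ^ (N ^ (i : ℕ))))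
        (X j.succ : MvPolynomial (Fin (n + 1)) k) = X j.succ + X 0 ^ (N ^ ((j : ℕ) + 1)) := by
  refine ⟨by simp, fun j => ?_⟩
  simp [Fin.succ_ne_zero]

/-- A power shear is injective (its inverse is the shear with the opposite sign). [folklore] -/
private theorem powShear_injective (h0 : T (X 0) = X 0)
    (hs : ∀ j : Fin n, T (X j.succ) = X j.succ + X 0 ^ (N ^ ((j : ℕ) + 1))) :
    Function.Injective T := by
  let T' : MvPolynomial (Fin (n + 1)) k →ₐ[k] MvPolynomial (Fin (n + 1)) k :=
    MvPolynomial.aeval fun i : Fin (n + 1) => if i = 0 then (X 0 : MvPolynomial (Fin (n + 1)) k)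
      else X i - X 0 ^ (N ^ (i : ℕ))
  have hcomp : T'.comp T = AlgHom.id _ _ := by
    refine MvPolynomial.algHom_ext fun i => ?_
    refine Fin.cases ?_ (fun j => ?_) i
    · rw [AlgHom.comp_apply, h0]
      simp [T']
    · rw [AlgHom.comp_apply, hs j, map_add, map_pow]
      simp [T', Fin.succ_ne_zero]
  intro a b h
  have := congrArg T' h
  rwa [← AlgHom.comp_apply, ← AlgHom.comp_apply, hcomp] at this

/-- Undoing the shear by evaluation: evaluating `T f` at `(x_0, z)` with
`z_j = x_{j+1} - x_0^{N^{j+1}}` gives `f(x)`. [folklore] -/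
private theorem aeval_cons_powShear {B : Type v} [CommRing B] [Algebra k B] (h0 : T (X 0) = X 0)
    (hs : ∀ j : Fin n, T (X j.succ) = X j.succ + X 0 ^ (N ^ ((j : ℕ) + 1)))
    (x : Fin (n + 1) → B) (z : Fin n → B) (hz : ∀ j, z j = x j.succ - x 0 ^ (N ^ ((j : ℕ) + 1)))
    (f : MvPolynomial (Fin (n + 1)) k) :
    MvPolynomial.aeval (Fin.cons (x 0) z : Fin (n + 1) → B) (T f) =
      MvPolynomial.aeval x f := by
  have hcomp : (MvPolynomial.aeval (Fin.cons (x 0) z : Fin (n + 1) → B)).comp T =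
      MvPolynomial.aeval x := by
    refine MvPolynomial.algHom_ext fun i => ?_
    refine Fin.cases ?_ (fun j => ?_) i
    · rw [AlgHom.comp_apply, h0]
      simp
    · rw [AlgHom.comp_apply, hs j, map_add, map_pow, MvPolynomial.aeval_X,
        MvPolynomial.aeval_X, MvPolynomial.aeval_X, Fin.cons_succ, Fin.cons_zero, hz j,
        sub_add_cancel]
  exact DFunLike.congr_fun hcomp f

/-! ### Monicity in `X_0` (after Mathlib's `NoetherNormalization.T_leadingcoeff_isUnit`) -/

section Monic

variable (N) (f : MvPolynomial (Fin (n + 1)) k) (v w : Fin (n + 1) →₀ ℕ)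

/-- Entries of `List.ofFn v` are values of `v`. [folklore] -/
private theorem lt_of_mem_ofFn {v : Fin (n + 1) →₀ ℕ} (vlt : ∀ i, v i < N) :
    ∀ l ∈ List.ofFn v, l < N := by
  intro l hl
  rw [List.mem_ofFn] at hl
  obtain ⟨i, rfl⟩ := hl
  exact vlt i

/-- Base-`N` expansions with digits `< N` are unique (after Mathlib's
`NoetherNormalization.sum_r_mul_neq`). [folklore] -/
private theorem sum_pow_mul_ne (h1 : 1 < N) (vlt : ∀ i, v i < N) (wlt : ∀ i, w i < N)
    (ne : v ≠ w) :
    ∑ x : Fin (n + 1), N ^ (x : ℕ) * v x ≠ ∑ x : Fin (n + 1), N ^ (x : ℕ) * w x := by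
  intro h
  refine ne <| Finsupp.ext <| congrFun <| List.ofFn_inj.mp ?_
  apply Nat.ofDigits_inj_of_len_eq h1 (by simp) (lt_of_mem_ofFn N vlt) (lt_of_mem_ofFn N wlt)
  simpa only [Nat.ofDigits_eq_sum_mapIdx, List.mapIdx_eq_ofFn, List.get_ofFn, List.length_ofFn,
    Fin.val_cast, mul_comm, List.sum_ofFn] using! h

variable {N}

/-- The `X_0`-degree of the shear of a monomial `a X^v` is `Σ_i N^i v_i`. [folklore] -/
private theorem degreeOf_zero_powShear_monomial (h0 : T (X 0) = X 0)
    (hs : ∀ j : Fin n, T (X j.succ) = X j.succ + X 0 ^ (N ^ ((j : ℕ) + 1))) (hN0 : 0 < N) {a : k}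
    (ha : a ≠ 0) :
    (T (monomial v a)).degreeOf 0 = ∑ i : Fin (n + 1), N ^ (i : ℕ) * v i := by
  rw [← natDegree_finSuccEquiv, monomial_eq, Finsupp.prod_pow v fun a ↦ X a]
  simp only [Fin.prod_univ_succ, Fin.sum_univ_succ, map_mul, map_prod, map_pow,
    MvPolynomial.algHom_C, h0, hs, map_add, finSuccEquiv_X_zero, finSuccEquiv_X_succ,
    algebraMap_eq]
  have h (i : Fin n) :
      (Polynomial.C (X (R := k) i) + Polynomial.X ^ N ^ ((i : ℕ) + 1)) ^ v i.succ ≠ 0 :=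
    pow_ne_zero (v i.succ) (leadingCoeff_ne_zero.mp <| by
      rw [add_comm, leadingCoeff_X_pow_add_C (pow_pos hN0 _)]; exact one_ne_zero)
  rw [natDegree_mul (by simp [ha]) (mul_ne_zero (by simp) (Finset.prod_ne_zero_iff.mpr
    (fun i _ ↦ h i))), natDegree_mul (by simp) (Finset.prod_ne_zero_iff.mpr (fun i _ ↦ h i)),
    natDegree_prod _ _ (fun i _ ↦ h i), natDegree_finSuccEquiv, degreeOf_C]
  simpa only [natDegree_pow, zero_add, natDegree_X, mul_one, Fin.val_zero, pow_zero, one_mul,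
    add_right_inj, Fin.val_succ] using Finset.sum_congr rfl (fun i _ ↦ by
    rw [add_comm (Polynomial.C _), natDegree_X_pow_add_C, mul_comm])

/-- Distinct monomials of `f` acquire distinct `X_0`-degrees under the shear. [folklore] -/
private theorem degreeOf_powShear_ne_of_ne (h0 : T (X 0) = X 0)
    (hs : ∀ j : Fin n, T (X j.succ) = X j.succ + X 0 ^ (N ^ ((j : ℕ) + 1))) (h1 : 1 < N)
    (hN : ∀ i, ∀ v ∈ f.support, v i < N) (hv : v ∈ f.support) (hw : w ∈ f.support) (ne : v ≠ w) :
    (T <| monomial v <| coeff v f).degreeOf 0 ≠ (T <| monomial w <| coeff w f).degreeOf 0 := by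
  rw [degreeOf_zero_powShear_monomial _ h0 hs (by omega) <| mem_support_iff.mp hv,
    degreeOf_zero_powShear_monomial _ h0 hs (by omega) <| mem_support_iff.mp hw]
  exact sum_pow_mul_ne N v w h1 (fun i ↦ hN i v hv) (fun i ↦ hN i w hw) ne

/-- The leading `X_0`-coefficient of the shear of the monomial `coeff v f · X^v` is the constant
`coeff v f`. [folklore] -/
private theorem leadingCoeff_finSuccEquiv_powShear_monomial (h0 : T (X 0) = X 0)
    (hs : ∀ j : Fin n, T (X j.succ) = X j.succ + X 0 ^ (N ^ ((j : ℕ) + 1))) (hN0 : 0 < N) :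
    (finSuccEquiv k n (T ((monomial v) (coeff v f)))).leadingCoeff =
    algebraMap k _ (coeff v f) := by
  rw [monomial_eq, Finsupp.prod_fintype]
  · simp only [map_mul, map_prod, leadingCoeff_mul, leadingCoeff_prod]
    rw [MvPolynomial.algHom_C, algebraMap_eq, finSuccEquiv_apply, eval₂Hom_C, RingHom.coe_comp]
    simp only [Function.comp_apply, leadingCoeff_C, map_pow, leadingCoeff_pow, algebraMap_eq]
    have : ∀ j, ((finSuccEquiv k n) (T (X j))).leadingCoeff = 1 := fun j ↦ by
      refine Fin.cases ?_ (fun i => ?_) j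
      · rw [h0]; simp [finSuccEquiv_apply]
      · rw [hs i, map_add, map_pow, finSuccEquiv_X_succ, finSuccEquiv_X_zero,
          add_comm, leadingCoeff_X_pow_add_C (pow_pos hN0 _)]
    simp only [this, one_pow, Finset.prod_const_one, mul_one]
  exact fun i ↦ pow_zero _

/-- **The power shear makes `f` monic in `X_0` up to a unit**: if `f ≠ 0`, `1 < N` and every
exponent occurring in `f` is `< N`, then the leading coefficient of `T f`, as a polynomial in
`X_0` over `k[X_1, …, X_n]`, is a unit (distinct monomials of `f` acquire distinct `X_0`-degrees
`Σ_i N^i v_i`, base-`N` expansions; Mathlib's `NoetherNormalization` is the case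
`N = 2 + deg f`). [folklore] -/
private theorem isUnit_leadingCoeff_finSuccEquiv_powShear (h0 : T (X 0) = X 0)
    (hs : ∀ j : Fin n, T (X j.succ) = X j.succ + X 0 ^ (N ^ ((j : ℕ) + 1))) (hf : f ≠ 0)
    (h1 : 1 < N) (hN : ∀ i, ∀ v ∈ f.support, v i < N) :
    IsUnit (finSuccEquiv k n (T f)).leadingCoeff := by
  obtain ⟨v, vin, vs⟩ := Finset.exists_max_image f.support
    (fun v ↦ (T ((monomial v) (coeff v f))).degreeOf 0) (support_nonempty.mpr hf)
  set h := fun w ↦ (MvPolynomial.monomial w) (coeff w f)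
  simp only [← natDegree_finSuccEquiv] at vs
  replace vs : ∀ x ∈ f.support \ {v}, (finSuccEquiv k n (T (h x))).degree <
      (finSuccEquiv k n (T (h v))).degree := by
    intro x hx
    obtain ⟨h1', h2⟩ := Finset.mem_sdiff.mp hx
    apply degree_lt_degree <| lt_of_le_of_ne (vs x h1') ?_
    simpa only [natDegree_finSuccEquiv]
      using degreeOf_powShear_ne_of_ne f _ _ h0 hs h1 hN h1' vin <| List.ne_of_not_mem_cons h2
  have coeff : (finSuccEquiv k n (T (h v + ∑ x ∈ f.support \ {v}, h x))).leadingCoeff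
      = (finSuccEquiv k n (T (h v))).leadingCoeff := by
    simp only [map_add, map_sum]
    rw [add_comm]
    apply leadingCoeff_add_of_degree_lt <| (lt_of_le_of_lt <| degree_sum_le _ _) ?_
    have h2 : h v ≠ 0 := by simpa [h] using mem_support_iff.mp vin
    replace h2 : (finSuccEquiv k n (T (h v))) ≠ 0 := fun eq ↦ h2 <|
      powShear_injective h0 hs (by simpa only [map_zero, map_eq_zero_iff _ (AlgEquiv.injective _)]
        using eq)
    exact (Finset.sup_lt_iff <| Ne.bot_lt (fun x ↦ h2 <| degree_eq_bot.mp x)).mpr vs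
  nth_rw 1 [← f.support_sum_monomial_coeff]
  rw [Finset.sum_eq_add_sum_sdiff_singleton_of_mem vin h]
  rw [leadingCoeff_finSuccEquiv_powShear_monomial f v h0 hs (by omega)] at coeff
  simpa only [coeff, algebraMap_eq] using (mem_support_iff.mp vin).isUnit.map MvPolynomial.C

end Monic

/-! ### Derivatives: the shear commutes with `∂/∂X_0` when `p ∣ N` -/

/-- For any commutative semiring `R`: `d/dY (finSuccEquiv R n g) = finSuccEquiv R n (∂g/∂X_0)`,
where `finSuccEquiv` views `g ∈ R[X_0, …, X_n]` as a polynomial in `Y = X_0` over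
`R[X_1, …, X_n]`. [folklore] -/
private theorem derivative_finSuccEquiv {R : Type v} [CommSemiring R] (g : MvPolynomial (Fin (n + 1)) R) :
    derivative (finSuccEquiv R n g) = finSuccEquiv R n (pderiv 0 g) := by
  induction g using MvPolynomial.induction_on with
  | C a =>
    rw [finSuccEquiv_apply, eval₂Hom_C, pderiv_C, map_zero]
    exact derivative_C
  | add p q hp hq => rw [map_add, derivative_add, hp, hq, map_add, map_add]
  | mul_X p i hp =>
    rw [map_mul, derivative_mul, hp, (pderiv 0).leibniz]
    simp only [smul_eq_mul, map_add, map_mul]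
    refine Fin.cases ?_ (fun j => ?_) i
    · rw [finSuccEquiv_X_zero, derivative_X, pderiv_X_self, map_one]
      ring
    · rw [finSuccEquiv_X_succ, derivative_C, pderiv_X_of_ne (Fin.succ_ne_zero j), map_zero]
      ring

/-- **The shear commutes with `∂/∂X_0` in characteristic dividing `N`**: if `(N : k) = 0` then
`∂_0 (T f) = T (∂_0 f)` — the chain-rule cross terms `N^i X_0^{N^i-1} · (∂_i f)` vanish.
[folklore] -/
private theorem pderiv_zero_powShear (h0 : T (X 0) = X 0)
    (hs : ∀ j : Fin n, T (X j.succ) = X j.succ + X 0 ^ (N ^ ((j : ℕ) + 1))) (hN : (N : k) = 0)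
    (f : MvPolynomial (Fin (n + 1)) k) : pderiv 0 (T f) = T (pderiv 0 f) := by
  induction f using MvPolynomial.induction_on with
  | C a => rw [MvPolynomial.algHom_C, algebraMap_eq, pderiv_C, map_zero]
  | add p q hp hq => rw [map_add, map_add, hp, hq, map_add, map_add]
  | mul_X p i hp =>
    have hNc : ((N : ℕ) : MvPolynomial (Fin (n + 1)) k) = 0 := by
      rw [← map_natCast (C : k →+* MvPolynomial (Fin (n + 1)) k) N, hN, map_zero]
    have key : pderiv 0 (T (X i)) = T (pderiv 0 (X i)) := by
      refine Fin.cases ?_ (fun j => ?_) i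
      · rw [h0, pderiv_X_self, map_one]
      · rw [hs j, pderiv_X_of_ne (Fin.succ_ne_zero j), map_zero, map_add,
          pderiv_X_of_ne (Fin.succ_ne_zero j), zero_add, pderiv_pow,
          pderiv_X_self, mul_one, Nat.cast_pow, hNc, zero_pow (Nat.succ_ne_zero _), zero_mul]
    rw [map_mul, (pderiv 0).leibniz, (pderiv 0).leibniz]
    simp only [smul_eq_mul, map_add, map_mul, hp, key]

end PowShear

/-! ### Separability from a derivative certificate -/

/-- An element `x` of a field extension `L/F` with `H(x) = 0` and `H'(x) ≠ 0` for some `H ∈ F[X]`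
is separable over `F` (the minimal polynomial divides `H`, so its derivative does not vanish at
`x`, hence is non-zero) — the conclusion "`h'(x_n) ≠ 0` … is separable in `X_n`" of
Huneke–Swanson's Lemma 4.2.1 (2). [cite: HunekeSwanson2006, Lemma 4.2.1 (2)] -/
theorem isSeparable_of_aeval_derivative_ne_zero {F L : Type*} [Field F] [Field L] [Algebra F L]
    (x : L) (H : F[X]) (hH : Polynomial.aeval x H = 0)
    (hH' : Polynomial.aeval x (derivative H) ≠ 0) : IsSeparable F x := by
  have hH0 : H ≠ 0 := by
    rintro rfl
    exact hH' (by rw [derivative_zero, map_zero])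
  have hint : IsIntegral F x := (isAlgebraic_iff_isIntegral).mp ⟨H, hH0, hH⟩
  obtain ⟨c, hc⟩ := minpoly.dvd F x hH
  have hder : Polynomial.aeval x (derivative (minpoly F x)) ≠ 0 := by
    intro h0
    apply hH'
    rw [hc, derivative_mul, map_add, map_mul, map_mul, h0, minpoly.aeval, zero_mul, zero_mul,
      add_zero]
  have hne : derivative (minpoly F x) ≠ 0 := fun h => hder (by rw [h, map_zero])
  exact (separable_iff_derivative_ne_zero (minpoly.irreducible hint)).mpr hne

/-! ### One step of separable Noether normalisation -/

section Step

variable {B : Type v} [CommRing B] [Algebra k B]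

/-- **One Nagata step, with derivative control.** Let `x_0, …, x_n ∈ B` satisfy a non-zero
relation `f(x) = 0` over `k`, let `1 < N` exceed every exponent of `f`, and put
`z_j = x_{j+1} - x_0^{N^{j+1}}`. Then there is a MONIC `h ∈ k[X_1, …, X_n][Y]` with
`h(z; x_0) = 0`, and if `(N : k) = 0` then `h'(z; x_0) = u · (∂f/∂X_0)(x)` for a unit `u ∈ B`
(`h` = the shear of `f` normalised by its unit leading coefficient; `∂_0` commutes with the
shear, `pderiv_zero_powShear`, and with `finSuccEquiv`, `derivative_finSuccEquiv`).
[cite: HunekeSwanson2006, Lemma 4.2.1 (2)] -/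
theorem exists_monic_aevalTower_eq_zero_of_powShear (x : Fin (n + 1) → B)
    {f : MvPolynomial (Fin (n + 1)) k} (hf : f ≠ 0) (hfx : MvPolynomial.aeval x f = 0) {N : ℕ}
    (h1 : 1 < N) (hN : ∀ i, ∀ v ∈ f.support, v i < N) (z : Fin n → B)
    (hz : ∀ j, z j = x j.succ - x 0 ^ (N ^ ((j : ℕ) + 1))) :
    ∃ h : Polynomial (MvPolynomial (Fin n) k), h.Monic ∧
      aevalTower (MvPolynomial.aeval z : MvPolynomial (Fin n) k →ₐ[k] B) (x 0) h = 0 ∧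
      ((N : k) = 0 → ∃ u : B, IsUnit u ∧
        aevalTower (MvPolynomial.aeval z : MvPolynomial (Fin n) k →ₐ[k] B) (x 0) (derivative h) =
          u * MvPolynomial.aeval x (pderiv 0 f)) := by
  obtain ⟨hT0, hTs⟩ := powShear_spec (k := k) (n := n) N
  set T : MvPolynomial (Fin (n + 1)) k →ₐ[k] MvPolynomial (Fin (n + 1)) k :=
    MvPolynomial.aeval (fun i : Fin (n + 1) => if i = 0 then (X 0 : MvPolynomial (Fin (n + 1)) k)
      else X i + X 0 ^ (N ^ (i : ℕ))) with hT
  have hu := isUnit_leadingCoeff_finSuccEquiv_powShear f hT0 hTs hf h1 hN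
  refine ⟨hu.unit⁻¹ • finSuccEquiv k n (T f),
    monic_of_isUnit_leadingCoeff_inv_smul hu, ?_, fun hNk => ?_⟩
  · rw [Units.smul_def, Polynomial.smul_eq_C_mul, map_mul,
      ← aeval_finCons_eq_aevalTower_finSuccEquiv, aeval_cons_powShear hT0 hTs x z hz, hfx,
      mul_zero]
  · refine ⟨MvPolynomial.aeval z (↑hu.unit⁻¹ : MvPolynomial (Fin n) k), ?_, ?_⟩
    · exact (Units.isUnit hu.unit⁻¹).map (MvPolynomial.aeval z)
    · rw [Units.smul_def, Polynomial.smul_eq_C_mul, derivative_mul, derivative_C, zero_mul,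
        zero_add, map_mul, Polynomial.aevalTower_C, derivative_finSuccEquiv,
        pderiv_zero_powShear hT0 hTs hNk, ← aeval_finCons_eq_aevalTower_finSuccEquiv,
        aeval_cons_powShear hT0 hTs x z hz]

/-- **The sheared family normalises `x_0`**: with `f`, `N`, `z` as above, `x_0` is integral over
`k[z_1, …, z_n]`. [cite: HunekeSwanson2006, Lemma 4.2.1 (1)] -/
theorem isIntegral_adjoin_powShear (x : Fin (n + 1) → B)
    {f : MvPolynomial (Fin (n + 1)) k} (hf : f ≠ 0) (hfx : MvPolynomial.aeval x f = 0) {N : ℕ}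
    (h1 : 1 < N) (hN : ∀ i, ∀ v ∈ f.support, v i < N) (z : Fin n → B)
    (hz : ∀ j, z j = x j.succ - x 0 ^ (N ^ ((j : ℕ) + 1))) :
    IsIntegral (Algebra.adjoin k (Set.range z)) (x 0) := by
  obtain ⟨h, hmonic, hroot, -⟩ := exists_monic_aevalTower_eq_zero_of_powShear x hf hfx h1 hN z hz
  set B' : Subalgebra k B := Algebra.adjoin k (Set.range z) with hB'
  let w : Fin n → B' := fun i => ⟨z i, Algebra.subset_adjoin ⟨i, rfl⟩⟩
  let φ : MvPolynomial (Fin n) k →ₐ[k] B' := MvPolynomial.aeval w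
  have hφ : (algebraMap B' B).comp (φ : MvPolynomial (Fin n) k →+* B') =
      (MvPolynomial.aeval z : MvPolynomial (Fin n) k →ₐ[k] B).toRingHom := by
    have hc : ((Algebra.ofId B' B).restrictScalars k).comp φ = MvPolynomial.aeval z := by
      refine MvPolynomial.algHom_ext fun i => ?_
      simp [φ, w]
    exact congrArg AlgHom.toRingHom hc
  refine ⟨h.map (φ : MvPolynomial (Fin n) k →+* B'), hmonic.map _, ?_⟩
  rw [Polynomial.eval₂_map, hφ]
  exact hroot

/-- The original family is recovered from `x_0` and the sheared family:
`x_{j+1} = z_j + x_0^{N^{j+1}}`; in particular `k[x] = k[x_0, z]` ("`k[z_1, …, z_{n-1}, y_n] =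
k[y_1, …, y_n]`" in the proof of Huneke–Swanson Thm. 4.2.2). [cite: HunekeSwanson2006, Thm. 4.2.2 (proof)] -/
theorem adjoin_range_eq_adjoin_cons_powShear (x : Fin (n + 1) → B) (N : ℕ) (z : Fin n → B)
    (hz : ∀ j, z j = x j.succ - x 0 ^ (N ^ ((j : ℕ) + 1))) :
    Algebra.adjoin k (Set.range x) = Algebra.adjoin k (Set.range (Fin.cons (x 0) z : Fin (n + 1) → B)) := by
  have h0 : x 0 ∈ Algebra.adjoin k (Set.range (Fin.cons (x 0) z : Fin (n + 1) → B)) :=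
    Algebra.subset_adjoin ⟨0, by simp⟩
  have hzj : ∀ j : Fin n, z j ∈ Algebra.adjoin k (Set.range (Fin.cons (x 0) z : Fin (n + 1) → B)) :=
    fun j => Algebra.subset_adjoin ⟨j.succ, by simp⟩
  have h0' : x 0 ∈ Algebra.adjoin k (Set.range x) := Algebra.subset_adjoin ⟨0, rfl⟩
  have hsucc : ∀ j : Fin n, x j.succ ∈ Algebra.adjoin k (Set.range x) :=
    fun j => Algebra.subset_adjoin ⟨j.succ, rfl⟩
  apply le_antisymm
  · refine Algebra.adjoin_le ?_
    rintro _ ⟨i, rfl⟩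
    refine Fin.cases ?_ (fun j => ?_) i
    · exact h0
    · have : x j.succ = z j + x 0 ^ (N ^ ((j : ℕ) + 1)) := by rw [hz j, sub_add_cancel]
      rw [this]
      exact add_mem (hzj j) (pow_mem h0 _)
  · refine Algebra.adjoin_le ?_
    rintro _ ⟨i, rfl⟩
    refine Fin.cases ?_ (fun j => ?_) i
    · simpa using h0'
    · rw [Fin.cons_succ, hz j]
      exact sub_mem (hsucc j) (pow_mem h0' _)

end Step

end Literature.RingTheory.NoetherNormalization

end
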